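import Summits.BirchSwinnertonDyer.Rank1Residual.ManinAdditive.TwoEisensteinRankExists
import HarnessLib
import HarnessLib.Audit.Tags

/-!
# The EISENSTEIN IDEAL of `E_{2,2p}` at the prime 2 and the additive level `4p`: E-imc-118…126 typed, with the kernel edges
# E-119 ∧ LIFT ⟹ E-81 and E-94 ∧ Mazur ∧ E-119 ∧ LIFT ⟹ E-85 (imc g17 MEMO-imc §23, PROOFS-g17; cell `bsd-f2-manin`, T-imc-16, typer g13)

HONEST FRAMING.  LENS = Iwasawa / Hecke-algebra (`bsd-f2-manin-imc` g17, planner-of-record).  SOURCE = HOME/imc/Sketch-imc-g17.lean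
59ad62fc9d3f9773 (257 l., farm rc 0 · 0 sorries; §A level `2p`, §B additive level `4p`), VERBATIM up to the `@[conjecture]` tags /
honest-framing sentences and the cite keys (`arXiv:1311.5275` ↦ `Yoo2015`, `arXiv:1604.02165` ↦ `Cesnavicius2018`,
`arXiv:1911.09446` ↦ `CesnaviciusNeururerSaha2023`); it imports the typer's `TwoEisensteinRankExists` (hex-free chains) and lives in
the leaf namespace `…ManinAdditive.TwoEisenstein` (no vocabulary re-declared).  CONTENT: **E-81 `TwoPNoTwoEisenstein` is a THEOREM
ON PAPER for every `p ≡ ±3 (mod 8)`** (MEMO-imc §23): THEOREM A `v₂[𝕋(Γ₀(2p)) : I_2] ≤ v₂(p² − 1) − 3` (E-imc-119, ⟸ INT₂ =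
E-imc-118: `w_p` preserves 2-integrality at `∞` on `M₂(Γ₀(2p))` — DR VI.6.9 + Česnavičius §2 run with `w_p`; constant term
`(p²−1)/(24p)` of `E_{2,2p}` at `1/2 = w_p(∞)`), `(p²−1)/8` odd for `p ≡ ±3 (8)`, + the routine LIFT ⟹ E-81
(`twoPNoTwoEisenstein_of_congruenceDepth`, kernel) and with E-94 ∧ Mazur ⟹ E-85 (`fourPTwoEisensteinRankOne_of_congruenceDepth`, via
`fourPTwoEisensteinRankOne_of_rankLaw'`); §B: the additive level `4p` (E-imc-122…126, THEOREM B(4p), the edges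
`fourP_no_twoTwoP_congruence_of_depth` / `fourP_no_zeroOne_congruence_mod_four`, the bookkeeping `zeroOneDepth`).  BC5 = imc ENGINE 5 /
5b (HOME/imc/kit-g17/: two engines PARI trace formula vs modular symbols + Atkin–Lehner denominators; `[𝕋(2p):I_2] = (p²−1)/24`
EXACTLY 36/36 odd `p ≤ 211`, bound attained, `w_p` 2-integral 36/36, control `w₂` non-integral; 4p table 11/11).  REFUTER VERDICTS:
REF1 §R70 (R-imc-46 + R-imc-48, HOME/ref1/R70-ref1-imc-g17.md 273a48013e319bbf, 2026-08-28T15:45Z): ALL NINE Props SURVIVE (E-118/119 and E-123/124 with VALID paper proofs — THEOREM B / A at 2p and 4p; E-120/122/125/126 as LAWS; LIFT with its status corrected to «Hecke duality + [Edixhoven1992 Thm 2.5/2.6]», GAP F-1), the three edges PROVED (axioms standard), BC7 CLEAN 9/9, KILLED 0 — verdict sentences folded per declaration below; REF2 R-imc-47 (placement vs Yoo 2016/19/21/23, Ohta 2014, Ribet–Yoo, ČNS 2019, Edixhoven 2006)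
pending.  bears_on: stmt-BirchSwinnertonDyer-22967 (C2 stub 6d: level-`2p` input E-81 is a paper theorem for ALL `p ≡ 5 (8)`;
remaining print/paper inputs E-94 + Mazur ℓ = 2 prime level + INT₂ + LIFT).  PARTITION 0 · beyond-print theorem: YES on paper
(REF1 §R70: A/B at 2p and 4p and COROLLARY C modulo the DR/KM/Čes16/ČNS19 model inputs and [Edixhoven1992 2.5/2.6]), no in the kernel · BSD is not proved by this; Manin's conjecture is not proved by this; C2 is not closed by this.
-/

set_option autoImplicit false

noncomputable section

open scoped MatrixGroups ModularForm
open CongruenceSubgroup UpperHalfPlane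
open Literature.NumberTheory.EllipticCurves Literature.NumberTheory.EllipticCurves.ModularForms

namespace Summit.BirchSwinnertonDyer.Rank1Residual.ManinAdditive.TwoEisenstein

/-! ### §A. Level `2p`: `E_{2,2p}`, INT₂, THEOREM A, LIFT, and the edges to E-81 / E-85 -/


/-- `b_n := σ(n) − 2σ(n/2)` (`n ≥ 1`): the coefficients of `E_{2,2}(z) = (E₂(z) − 2E₂(2z))/(−24) = 1/24 + ∑_{n≥1} b_n qⁿ`,
the weight-2 Eisenstein series of level 2 (`U₂ = 1`, `T_r = 1 + r`). [folklore] -/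
def eisTwoTwoCoeff (n : ℕ) : ℤ :=
  ((ArithmeticFunction.sigma 1 n : ℕ) : ℤ) - 2 * (if 2 ∣ n then ((ArithmeticFunction.sigma 1 (n / 2) : ℕ) : ℤ) else 0)

/-- `a_n(E_{2,2p}) := b_n − b_{n/p}` (`n ≥ 1`; `a₀ = 0`): the coefficients at `∞` of `E_{2,2p}(z) = E_{2,2}(z) − E_{2,2}(pz)`
`= [p]⁻[2]⁺(e)` (Yoo 2016, Def. 2.5 / §2.3: `U₂ = 1`, `U_p = p`, `T_r = 1 + r`), annihilated by
`I_2 = (U₂ − 1, U_p − p, T_r − r − 1 : r ∤ 2p)`. [cite: Yoo2015, Def. 2.5, Prop. 2.6] -/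
def eisTwoTwoPCoeff (p n : ℕ) : ℤ :=
  eisTwoTwoCoeff n - (if p ∣ n then eisTwoTwoCoeff (n / p) else 0)

/-- "`z` is a 2-integral rational number" (`z = r` with `r ∈ ℚ`, `den r` odd, i.e. `r ∈ ℤ₍₂₎`). [folklore] -/
def IsTwoAdicRat (z : ℂ) : Prop :=
  ∃ r : ℚ, Odd r.den ∧ (r : ℂ) = z

/-- **Candidate E-imc-118 `AtkinLehnerTwoAdicIntegralTwoP` (INT₂; THEOREM on paper, MEMO-imc §23.3).**  For an odd prime `p`
and the Atkin–Lehner matrix `W_p = (p a; 2p pb)`, `pb − 2a = 1` (so `det W_p = p`, `W_p ∞ = 1/2`), and every `f ∈ M₂(Γ₀(2p))`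
whose `q`-expansion at `∞` has 2-INTEGRAL RATIONAL coefficients, the `q`-expansion at `∞` of `f ∣₂ W_p` (Mathlib slash, factor
`det^{k−1} = p`) again has 2-integral rational coefficients.  Proof on paper: `X₀(2p)_{𝔽₂} = X^μ ∪ X^{ét}` (Deligne–Rapoport
VI.6.9), `U^μ := X₀(2p)_{ℤ₍₂₎} ∖ X^{ét}` is `ℤ₍₂₎`-smooth with irreducible special fibre and formal completion `Spf ℤ₍₂₎⟦q⟧` along
`∞`, so `f` is 2-integral at `∞` iff `ω_f = f dq/q` is regular at the generic point of `X^μ` (Česnavičius 2016, proof of Lemma 2.?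
«hop-f»); the moduli involution `w_p : (E, C₂, C_p) ↦ (E/C_p, C₂, E[p]/C_p)` is defined over `ℤ[1/p] ⊇ ℤ₍₂₎` and FIXES the
generic point of `X^μ` (a degree-`p` isogeny preserves the connectedness of the `Γ₀(2)`-structure), and `w_p^* ω_f = ω_{f∣W_p}`.
(Contrast: `w₂` SWAPS `X^μ`, `X^{ét}` and does NOT preserve 2-integrality — `S₂(p) ∋ f ↦ f(2z) ↦ f/2`.)
Why it might fail: only through a normalisation slip (`det` factor, which is the 2-adic unit `p`); rationality of the
coefficients of `f ∣ W_p` uses that all cusps of `X₀(2p)` are rational. [cite: Cesnavicius2018, §2 (spec-fib), (hop-f)]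
Cell bsd-f2-manin row E-imc-118 (INT₂; THEOREM on paper — MEMO-imc §23.3 / PROOFS-g17 §2); typed VERBATIM from HOME/imc/Sketch-imc-g17.lean 59ad62fc9d3f9773 (typer g13, T-imc-16); REF1 §R70 (R-imc-46/48, HOME/ref1/R70-ref1-imc-g17.md 273a48013e319bbf, 2026-08-28T15:45Z; kernel ref1-C77-imc-g17-audit.lean 2b1e3c6fcaef7823 rc 0, axioms 8/8 standard; BC7 probes ref1-C77P 8c8bb2d857814607 CLEAN 9/9): SURVIVES — paper proof of THEOREM B VALID (precision P-B1: in (2b)/(2c) the log divisor must be C = s_∞ + s_{1/2} + (0)_ℚ + (1/p)_ℚ, all generic-fibre cusps), typed faithfully (T-1…T-4: `IsTwoAdicRat` = «z ∈ ℤ₍₂₎», `qExpansion 1 (f ∣ W)` is the Fourier expansion because W_p normalises Γ₀(2p)); nothing asserted.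
[conjecture — cell candidate / theorem on paper, NOT a tree fact] -/
@[conjecture]
def AtkinLehnerTwoAdicIntegralTwoP : Prop :=
  ∀ (p : ℕ), p.Prime → Odd p → ∀ (a b : ℤ), (p : ℤ) * b - 2 * a = 1 →
    ∀ W : GL (Fin 2) ℝ, (W : Matrix (Fin 2) (Fin 2) ℝ) = !![(p : ℝ), (a : ℝ); (2 * p : ℝ), (p * b : ℝ)] →
      ∀ f : ModularForm (Gamma0 (2 * p)) 2,
        (∀ n, IsTwoAdicRat ((qExpansion 1 ⇑f).coeff n)) →
          ∀ n, IsTwoAdicRat ((qExpansion 1 ((⇑f) ∣[(2 : ℤ)] W)).coeff n)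

/-- `F ≡ E_{2,2p} (mod 2^a)` at `∞`, coefficientwise for `n ≥ 1` (both constant terms vanish), for an INTEGRAL cusp form `F`. [folklore] -/
def IsEisTwoTwoPCongruent (p a : ℕ) [NeZero (2 * p)] (F : CuspForm (Gamma0 (2 * p)) 2) : Prop :=
  F ∈ integralCuspForms0 (2 * p) 2 ∧
    ∀ n, 1 ≤ n → ∃ z : ℤ, (z : ℂ) = cuspCoeff F n ∧ (2 : ℤ) ^ a ∣ z - eisTwoTwoPCoeff p n

/-- **Candidate E-imc-119 `TwoPEisensteinCongruenceDepth` (THEOREM on paper ⟸ E-118; MEMO-imc §23.3; the lens statement).**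
For an odd prime `p`: if some `F ∈ S₂(Γ₀(2p); ℤ)` satisfies `a_n(F) ≡ a_n(E_{2,2p}) (mod 2^a)` for all `n ≥ 1`, then
`2^a ∣ (p² − 1)/8`.  Equivalently (duality `S₂(ℤ) ≅ Hom_ℤ(𝕋, ℤ)`, Yoo L3.1 `𝕋/I_2 ≅ ℤ/n`): `v₂ [𝕋(Γ₀(2p)) : I_2] ≤ v₂(p² − 1) − 3`,
`I_2 = (U₂ − 1, U_p − p, T_r − r − 1 : r ∤ 2p prime)`.  Proof: `H := (F − E_{2,2p})/2^a ∈ M₂(ℤ₍₂₎)`; by E-118 `H ∣ W_p ∈ M₂(ℤ₍₂₎)`;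
its constant term is `−a₀(E_{2,2p} ∣ W_p)/2^a = −(p² − 1)/(24p·2^a)` (`E_{2,2} ∣ W_p = p E_{2,2}(pz)`, `E_{2,2}(p·) ∣ W_p = p⁻¹ E_{2,2}`).
For `p ≡ ±3 (mod 8)` (`v₂(p² − 1) = 3`): NO cusp form is `≡ E_{2,2p} (mod 2)`, i.e. `[𝕋 : I_2]` is odd — which kills every
maximal ideal `𝔪 ∋ 2` of `𝕋(2p)` that is Eisenstein (`U₂, U_p ≡ ±1 ≡ 1`), new or old: tree E-imc-81 (edge below).
BC5 = ENGINE 5 (HOME/imc/kit-g17/eisidx.gp, two engines: trace formula / modular symbols): `v₂[𝕋(2p) : I_2]` vs `v₂(p² − 1) − 3`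
for all odd `p ≤ 300` (table HOME/imc/g17-eisidx-*.txt).  Why it might fail: only if INT₂ fails (a `det`/width normalisation at the
cusp `1/2`), which the `p ≡ ±1 (mod 8)` rows of the census test independently of E-81. [cite: Yoo2015, Thm. 1.1, Lemma 3.1, Thm. 3.2 (index of I_M away from 2; shape)]
Cell bsd-f2-manin row E-imc-119 (THEOREM on paper ⟸ E-118; THEOREM A); typed VERBATIM from HOME/imc/Sketch-imc-g17.lean 59ad62fc9d3f9773 (typer g13, T-imc-16); REF1 §R70 (R-imc-46/48, HOME/ref1/R70-ref1-imc-g17.md 273a48013e319bbf, 2026-08-28T15:45Z; kernel ref1-C77-imc-g17-audit.lean 2b1e3c6fcaef7823 rc 0, axioms 8/8 standard; BC7 probes ref1-C77P 8c8bb2d857814607 CLEAN 9/9): SURVIVES — VALID ⟸ E-118 via (S1)+(S3), every displayed identity re-derived; nothing asserted.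
[conjecture — cell candidate / theorem on paper, NOT a tree fact] -/
@[conjecture]
def TwoPEisensteinCongruenceDepth : Prop :=
  ∀ (p : ℕ) [NeZero (2 * p)], p.Prime → Odd p → ∀ a : ℕ,
    (∃ F : CuspForm (Gamma0 (2 * p)) 2, IsEisTwoTwoPCongruent p a F) → 2 ^ a ∣ (p ^ 2 - 1) / 8

/-- **Candidate E-imc-120 `TwoPEisensteinCongruenceDepthSharp` (LAW; census ENGINE 5; = «the 2-part of Yoo's index theorem
`𝕋/I_M ≅ ℤ/|C_{M,N}|` holds for `(M, N) = (2, 2p)`», the cuspidal divisor `C_{2,2p}` having order with 2-part `2^{v₂(p²−1)−3}`).**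
For every odd prime `p` there IS an integral cusp form `F ≡ E_{2,2p} (mod 2^{v₂(p²−1)−3})` at `∞` (trivial, `F = 0`, when
`p ≡ ±3 (mod 8)`).  Why it might fail: `𝕋/I_2` might act on `⟨C_{2,2p}⟩` with a kernel at 2 (multiplicity-one failure at the
four colliding 2-Eisenstein ideals, PROOFS-g16 Rem. 9.5). [cite: Yoo2015, Thm. 1.1 (ℓ ∤ 2N part; the ℓ = 2 equality is the cell's E-imc-120)]
Cell bsd-f2-manin row E-imc-120 (LAW; ENGINE 5 28/28, bound attained); typed VERBATIM from HOME/imc/Sketch-imc-g17.lean 59ad62fc9d3f9773 (typer g13, T-imc-16); REF1 §R70 (R-imc-46/48, HOME/ref1/R70-ref1-imc-g17.md 273a48013e319bbf, 2026-08-28T15:45Z; kernel ref1-C77-imc-g17-audit.lean 2b1e3c6fcaef7823 rc 0, axioms 8/8 standard; BC7 probes ref1-C77P 8c8bb2d857814607 CLEAN 9/9): SURVIVES as LAW (degenerate-true at p ≡ ±3 (8) by F = 0, content at p ≡ ±1 (8); census 36/36 imc HARVEST); nothing asserted.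
[conjecture — cell candidate / theorem on paper, NOT a tree fact] -/
@[conjecture]
def TwoPEisensteinCongruenceDepthSharp : Prop :=
  ∀ (p : ℕ) [NeZero (2 * p)], p.Prime → Odd p →
    ∃ F : CuspForm (Gamma0 (2 * p)) 2, IsEisTwoTwoPCongruent p (padicValNat 2 (p ^ 2 - 1) - 3) F

/-- **Support `TwoPTwoEisensteinLift` (Hecke-algebra lemma; on paper = Hecke duality + ONE print input at the prime 2, [Edixhoven1992, Thm. 2.5/2.6] — REF1 §R70 GAP F-1, see below; imc's text «routine»: `𝕋` finite flat over `ℤ`, `S₂(ℤ) ≅ Hom_ℤ(𝕋, ℤ)`;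
on `S₂(Γ₀(2p))` one has `U_p² = 1` (no `p`-old forms since `S₂(Γ₀(2)) = 0`) and `U₂(U₂ − T₂^{(p)}) ≡ 0` on 2-old forms, so
every 2-Eisenstein maximal ideal of the ANEMIC algebra lies under a maximal ideal `𝔪 ⊇ (2, I_2)` of the full `𝕋`; then
`𝕋 → 𝕋/(2, I_2) = 𝔽₂` dualises to an integral `F ≡ E_{2,2p} (mod 2)`).**
[cite: Edixhoven1992, Thm. 2.5 and Thm. 2.6 (shape only: Deligne's and Fontaine's descriptions of ρ̄_f|D₂ for ordinary / supersingular f, 2 ≤ k ≤ ℓ + 1 — the print input that gives ā₂(f) = 1 for a 2-old odd-anemic 2-Eisenstein pair (REF1 §R70 F-1); the Lift itself is the cell's support row, NOT in print)]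
Cell bsd-f2-manin row support LIFT (routine Hecke-algebra lemma on paper, PROOFS-g17 §4); typed VERBATIM from HOME/imc/Sketch-imc-g17.lean 59ad62fc9d3f9773 (typer g13, T-imc-16); REF1 §R70 (R-imc-46/48, HOME/ref1/R70-ref1-imc-g17.md 273a48013e319bbf, 2026-08-28T15:45Z; kernel ref1-C77-imc-g17-audit.lean 2b1e3c6fcaef7823 rc 0, axioms 8/8 standard; BC7 probes ref1-C77P 8c8bb2d857814607 CLEAN 9/9): SURVIVES, STATUS CORRECTED — NOT «routine»: routine Hecke duality/algebra + ONE print input at the prime 2 (GAP F-1: «a₂(f) ≡ 1 (mod λ)» for a 2-old odd-anemic-Eisenstein pair does not follow from the anemic condition; fill = [cite: Edixhoven1992, Thm. 2.5 (Deligne, ordinary ⇒ Frob₂ acts on the unramified quotient by ā₂ ⇒ ā₂ = 1) and Thm. 2.6 (Fontaine, supersingular ⇒ ρ̄|I₂ = ψ ⊕ ψ² ≠ 1 ⊕ 1)], valid at (ℓ, k) = (2, 2); or Mazur 1977 = tree `MazurNoTwoEisensteinPrimeLevel` for p ≢ 1 (8)); COROLLARY C (E-81, p ≡ ±3 (8))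 is then a THEOREM ON PAPER, Mazur-free via Edixhoven 1992; nothing asserted.
[conjecture — cell candidate / theorem on paper, NOT a tree fact] -/
@[conjecture]
def TwoPTwoEisensteinLift : Prop :=
  ∀ (p : ℕ) [NeZero (2 * p)], p.Prime → Odd p →
    (∃ g : CuspForm (Gamma0 (2 * p)) 2, IsTwoEisensteinNilpotent (2 * p) g ∧ ¬ IsTwiceIntegral (2 * p) g) →
      ∃ F : CuspForm (Gamma0 (2 * p)) 2, IsEisTwoTwoPCongruent p 1 F

/-- `(p² − 1)/8` is odd for `p ≡ ±3 (mod 8)`. [folklore] -/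
theorem not_two_dvd_sq_sub_one_div_eight {p : ℕ} (h : p % 8 = 3 ∨ p % 8 = 5) : ¬ 2 ∣ (p ^ 2 - 1) / 8 := by
  rcases h with h | h
  · obtain ⟨k, rfl⟩ : ∃ k, p = 8 * k + 3 := ⟨p / 8, by omega⟩
    have h1 : (8 * k + 3) ^ 2 = 8 * (2 * (4 * k ^ 2 + 3 * k) + 1) + 1 := by ring
    omega
  · obtain ⟨k, rfl⟩ : ∃ k, p = 8 * k + 5 := ⟨p / 8, by omega⟩
    have h1 : (8 * k + 5) ^ 2 = 8 * (2 * (4 * k ^ 2 + 5 * k + 1) + 1) + 1 := by ring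
    omega

/-- **EDGE (kernel-checked): E-imc-119 ∧ Lift ⟹ tree E-imc-81 `TwoPNoTwoEisenstein`** — the level-`2p` input of the blind tame
family route (stub 6d of `kato_shift_two`, via E-imc-94♭: E-85 ⟸ E-94 ∧ Mazur ∧ E-81). [folklore] -/
theorem twoPNoTwoEisenstein_of_congruenceDepth (h119 : TwoPEisensteinCongruenceDepth)
    (hlift : TwoPTwoEisensteinLift) : TwoPNoTwoEisenstein := by
  intro p _ hp hmod g hg
  by_contra hne
  have hp2 : p ≠ 2 := by rintro rfl; omega
  have hodd : Odd p := hp.odd_of_ne_two hp2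
  obtain ⟨F, hF⟩ := hlift p hp hodd ⟨g, hg, hne⟩
  have h2 : 2 ^ 1 ∣ (p ^ 2 - 1) / 8 := h119 p hp hodd 1 ⟨F, hF⟩
  exact not_two_dvd_sq_sub_one_div_eight hmod (by simpa using h2)

/-- **CHAIN to stub 6d's tree input (kernel-checked, by name): E-94 ∧ Mazur(prime level, 2-adic) ∧ E-imc-119 ∧ Lift ⟹ E-imc-85
`FourPTwoEisensteinRankOne`** (via the tree's `hex`-free `fourPTwoEisensteinRankOne_of_rankLaw'`, p638763). [folklore] -/
theorem fourPTwoEisensteinRankOne_of_congruenceDepth (hlaw : FourPTwoPRankLaw)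
    (hMazur : MazurNoTwoEisensteinPrimeLevel) (h119 : TwoPEisensteinCongruenceDepth)
    (hlift : TwoPTwoEisensteinLift) : FourPTwoEisensteinRankOne :=
  fourPTwoEisensteinRankOne_of_rankLaw' hlaw hMazur (twoPNoTwoEisenstein_of_congruenceDepth h119 hlift)

/-! ### §B. The ADDITIVE level `4p` (MEMO-imc §23 (10); ENGINE 5b = HOME/imc/kit-g17/eisidx4p.gp)

At level `4p` (`p` odd) the fibre `X₀(4p)_{𝔽₂}` of the Katz–Mazur model has THREE reduced components `Z₂₀ ∋ ∞, 1/4`,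
`Z₁₁ ∋ 1/2, 1/(2p)`, `Z₀₂ ∋ 0, 1/p`; `w_p` fixes each, `w₄` swaps `Z₂₀ ↔ Z₀₂`.  THEOREM B(4p): `w_p` preserves
2-integrality at `∞` (same proof as at `2p`: `X₀(N)^∞` is `ℤ`-smooth for every `N`, ČNS arXiv:1911.09446 §1).
Transport to `Z₁₁` = integrality of the TRACE `Tr^{4p}_{2p} f = f + f∣γ`, `γ = (1 0; 2p 1)`; to `Z₀₂` = of `f ∣ W₄`;
both cost `2⁴` on `M₂` (constant term of `E_{2,2}` at the cusp `0` is `−1/48`): LAW E-imc-122.  The `u₂ = 0`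
Eisenstein series `E⁰ := E_{2,2}(z) − E_{2,2}(2z)` and its `p`-stabilisations `E^{(0,p)} = E⁰ − E⁰(p·)`,
`E^{(0,1)} = E⁰ − pE⁰(p·)` (the Eisenstein systems of the `4p`-NEW 2-Eisenstein maximal ideal `𝔐₀ = (2, U₂, U_p − 1,
T_r − 1 − r)`) have VANISHING constant term at both cusps of `Z₂₀`, so their congruence depth is bounded only through
`Z₁₁`/`Z₀₂`: `≤ v₂(p − 1)` resp. `≤ v₂(p² − 1)` — blind to the last 2-adic digit; the statement that decides E-85 at `4p`
is a MULTIPLICITY (`rank_{ℤ₂} 𝕋(4p)_{𝔐₀} = 1`), not a depth, whence the rank law E-94 stays the necessary input. -/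

/-- `a_n(E⁰)`, `E⁰ := E_{2,2}(z) − E_{2,2}(2z)` (the weight-2 Eisenstein series of level 4 with `U₂ E⁰ = 0`, `a₀ = 0`, `a₁ = 1`). [folklore] -/
def eisZeroCoeff (n : ℕ) : ℤ :=
  eisTwoTwoCoeff n - (if 2 ∣ n then eisTwoTwoCoeff (n / 2) else 0)

/-- `a_n(E^{(0,1)})`, `E^{(0,1)} := E⁰(z) − p·E⁰(pz)` (level `4p`, `U₂ = 0`, `U_p = 1`, `T_r = 1 + r`; `a₀ = 0`, `a₁ = 1`). [folklore] -/
def eisZeroOneCoeff (p n : ℕ) : ℤ :=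
  eisZeroCoeff n - (if p ∣ n then (p : ℤ) * eisZeroCoeff (n / p) else 0)

/-- `a_n(E^{(0,p)})`, `E^{(0,p)} := E⁰(z) − E⁰(pz)` (level `4p`, `U₂ = 0`, `U_p = p`, `T_r = 1 + r`; `a₀ = 0`, `a₁ = 1`). [folklore] -/
def eisZeroPCoeff (p n : ℕ) : ℤ :=
  eisZeroCoeff n - (if p ∣ n then eisZeroCoeff (n / p) else 0)

/-- `F ≡ E (mod 2^a)` at `∞` for `n ≥ 1`, for an integral cusp form `F` of level `4p` and an integral coefficient sequence `e`. [folklore] -/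
def IsCongruentAtFourP (p a : ℕ) [NeZero (4 * p)] (e : ℕ → ℤ) (F : CuspForm (Gamma0 (4 * p)) 2) : Prop :=
  F ∈ integralCuspForms0 (4 * p) 2 ∧
    ∀ n, 1 ≤ n → ∃ z : ℤ, (z : ℂ) = cuspCoeff F n ∧ (2 : ℤ) ^ a ∣ z - e n

/-- **Candidate E-imc-123 `AtkinLehnerTwoAdicIntegralFourP` (= THEOREM B(4p), paper; MEMO-imc §23 (10a)).**  For an odd prime
`p`, `W_p = (p a; 4p pb)` with `pb − 4a = 1`: if `f ∈ M₂(Γ₀(4p))` has 2-integral `q`-expansion at `∞` (all `n ≥ 0`), so does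
`f ∣₂ W_p`.  (The cusps `∞`, `1/4 = w_p ∞` lie on the `μ₄`-component `Z₂₀`; `w_p` is the moduli involution
`(E, C₄, C_p) ↦ (E/C_p, C₄, E[p]/C_p)` over `ℤ₍₂₎` and fixes the generic point of `Z₂₀`.)  BC5 = ENGINE 5b columns
`AL wp[cusp,full]` (= 0) and `cuspden[1/4]` (= 0): 5/5 levels `p ≤ 13` (smoke j310310), full run j310430.  CONTROL: `w₄`
has `v₂`-denominator exactly `4` on `M₂(ℤ)` at every level tested. [cite: CesnaviciusNeururerSaha2023, §1 (X₀(N)^∞ and integrality at ∞; shape)]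
Cell bsd-f2-manin row E-imc-123 (THEOREM B(4p) on paper); typed VERBATIM from HOME/imc/Sketch-imc-g17.lean 59ad62fc9d3f9773 (typer g13, T-imc-16); REF1 §R70 (R-imc-46/48, HOME/ref1/R70-ref1-imc-g17.md 273a48013e319bbf, 2026-08-28T15:45Z; kernel ref1-C77-imc-g17-audit.lean 2b1e3c6fcaef7823 rc 0, axioms 8/8 standard; BC7 probes ref1-C77P 8c8bb2d857814607 CLEAN 9/9): SURVIVES — VALID ((6a) the three components (2,0), (1,1), (0,2) of X₀(4p) ⊗ 𝔽₂ all REDUCED, KM 13.4.7 multiplicities φ(2^{min(a,b)}) = 1,1,1; (6b) w_p preserves KM types); nothing asserted.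
[conjecture — cell candidate / theorem on paper, NOT a tree fact] -/
@[conjecture]
def AtkinLehnerTwoAdicIntegralFourP : Prop :=
  ∀ (p : ℕ), p.Prime → Odd p → ∀ (a b : ℤ), (p : ℤ) * b - 4 * a = 1 →
    ∀ W : GL (Fin 2) ℝ, (W : Matrix (Fin 2) (Fin 2) ℝ) = !![(p : ℝ), (a : ℝ); (4 * p : ℝ), (p * b : ℝ)] →
      ∀ f : ModularForm (Gamma0 (4 * p)) 2,
        (∀ n, IsTwoAdicRat ((qExpansion 1 ⇑f).coeff n)) →
          ∀ n, IsTwoAdicRat ((qExpansion 1 ((⇑f) ∣[(2 : ℤ)] W)).coeff n)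

/-- **Candidate E-imc-124 `FourPOldEisensteinCongruenceDepth` (THEOREM on paper ⟸ E-123, verbatim the `2p` argument: `W_p^{(4p)}`
is also a `W_p^{(2p)}`, so `a₀(E_{2,2p} ∣ W_p^{(4p)}) = (p² − 1)/(24p)`; MEMO-imc §23 (10a)).**  At level `4p`: a cusp form
`F ∈ S₂(Γ₀(4p); ℤ)` with `F ≡ E_{2,2p} (mod 2^a)` (`n ≥ 1`) forces `2^a ∣ (p² − 1)/8`; i.e. `v₂[𝕋(4p) : I_{(1,p)}] ≤ v₂(p²−1) − 3`,
`I_{(1,p)} = (U₂ − 1, U_p − p, T_r − 1 − r)`.  COROLLARY (p ≡ ±3 (8)): `𝔐₁ = (2, U₂ − 1, U_p − 1, T_r − 1 − r)` is the unit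
ideal of `𝕋(4p)` — no 2-Eisenstein eigenform of level `p` (its ordinary `U₂`-root is `≡ a₂ ≡ 1`) or `2p` (`U₂ = ±1`): this
REPROVES Mazur's prime-level `ℓ = 2` statement for `p ≡ ±3 (8)` and E-81, inside `𝕋(4p)` (REF1 §R70 (6d)(i): the level-`p` half only as B(4p) + [Edixhoven1992, Thm. 2.5/2.6] — «its ordinary `U₂`-root is `≡ a₂ ≡ 1`» IS the F-1 input; the level-`2p` half is input-free).  BC5 = ENGINE 5b column `(1,p)`:
index odd at `p = 5, 11, 13`, `v₂ = 1 = A(7)` at `p = 7` (5/5 within the bound, 4/4 sharp). [cite: Yoo2015, Lemma 3.1 (shape: 𝕋/I cyclic)]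
Cell bsd-f2-manin row E-imc-124 (THEOREM on paper ⟸ E-123); typed VERBATIM from HOME/imc/Sketch-imc-g17.lean 59ad62fc9d3f9773 (typer g13, T-imc-16); REF1 §R70 (R-imc-46/48, HOME/ref1/R70-ref1-imc-g17.md 273a48013e319bbf, 2026-08-28T15:45Z; kernel ref1-C77-imc-g17-audit.lean 2b1e3c6fcaef7823 rc 0, axioms 8/8 standard; BC7 probes ref1-C77P 8c8bb2d857814607 CLEAN 9/9): SURVIVES — VALID ⟸ E-123 ((6c)); the docstring COROLLARY «REPROVES Mazur's prime-level ℓ = 2 statement for p ≡ ±3 (8)» holds only as B(4p) + [cite: Edixhoven1992, Thm. 2.5/2.6] ((6d)(i) inherits GAP F-1: an ā₂ = 0 level-p form would sit under 𝔐₀, where (6e) is a no-go); the level-2p half (E-81 inside 𝕋(4p), (6d)(ii)) needs no such input; nothing asserted.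
[conjecture — cell candidate / theorem on paper, NOT a tree fact] -/
@[conjecture]
def FourPOldEisensteinCongruenceDepth : Prop :=
  ∀ (p : ℕ) [NeZero (4 * p)], p.Prime → Odd p → ∀ a : ℕ,
    (∃ F : CuspForm (Gamma0 (4 * p)) 2, IsCongruentAtFourP p a (eisTwoTwoPCoeff p) F) → 2 ^ a ∣ (p ^ 2 - 1) / 8

/-- **Candidate E-imc-122 `FourPZeroEisensteinCongruenceDepth` (LAW, CONDITIONAL consequence of the transport exponent `4` to the
middle component `Z₁₁`, MEMO-imc §23 (10b–c); the honest reach of constant terms at additive level).**  At level `4p`: a cusp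
form `F ≡ E^{(0,1)} (mod 2^a)` (`n ≥ 1`) forces `2^a ∣ p − 1` (constant term of `E^{(0,1)}` at the cusp `1/(2p)` is
`−(p − 1)/16`, transport exponent `4`); and `F ≡ E^{(0,p)} (mod 2^a)` forces `2^a ∣ p² − 1` (constant term `(p²−1)/(16p²)` at
`1/2`).  For `p ≡ 3 (mod 4)` the first bound is `a ≤ 1` (sharp at `p = 7`: depth 1 from the `2p`-old form 14a; true depth 0 at
`p ≡ 3 (8)` by E-86 — the last 2-adic digit is invisible to constant terms).  BC5 = ENGINE 5b columns `(0,1)`, `(0,p)`: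
depths `1,1,0,1` / `1,1,0,1` at `p = 5, 7, 11, 13` against bounds `2,1,1,2` / `3,4,3,3`. [conjecture]
Cell bsd-f2-manin row E-imc-122 (LAW, conditional on the transport exponent); typed VERBATIM from HOME/imc/Sketch-imc-g17.lean 59ad62fc9d3f9773 (typer g13, T-imc-16); REF1 §R70 (R-imc-46/48, HOME/ref1/R70-ref1-imc-g17.md 273a48013e319bbf, 2026-08-28T15:45Z; kernel ref1-C77-imc-g17-audit.lean 2b1e3c6fcaef7823 rc 0, axioms 8/8 standard; BC7 probes ref1-C77P 8c8bb2d857814607 CLEAN 9/9): SURVIVES as CONDITIONAL LAW (transport exponent 4 and the cusp-1/2p constant terms not re-derived by REF1); nothing asserted.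
[conjecture — cell candidate / theorem on paper, NOT a tree fact] -/
@[conjecture]
def FourPZeroEisensteinCongruenceDepth : Prop :=
  ∀ (p : ℕ) [NeZero (4 * p)], p.Prime → Odd p → ∀ a : ℕ,
    ((∃ F : CuspForm (Gamma0 (4 * p)) 2, IsCongruentAtFourP p a (eisZeroOneCoeff p) F) → 2 ^ a ∣ p - 1) ∧
    ((∃ F : CuspForm (Gamma0 (4 * p)) 2, IsCongruentAtFourP p a (eisZeroPCoeff p) F) → 2 ^ a ∣ p ^ 2 - 1)

/-- **Candidate E-imc-125 `FourPNoZeroEisensteinThreeModEight` (LAW = the index form of tree E-86 at the new maximal ideal `𝔐₀`;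
census ENGINE 5b: all eight Eisenstein indices odd at `p = 11`; NOT reachable by constant terms (E-122 gives only depth ≤ 1)).**
For `p ≡ 3 (mod 8)` no integral cusp form of level `4p` is `≡ E^{(0,1)} (mod 2)`. [conjecture]
Cell bsd-f2-manin row E-imc-125 (LAW = index form of tree E-86 at 𝔐₀); typed VERBATIM from HOME/imc/Sketch-imc-g17.lean 59ad62fc9d3f9773 (typer g13, T-imc-16); REF1 §R70 (R-imc-46/48, HOME/ref1/R70-ref1-imc-g17.md 273a48013e319bbf, 2026-08-28T15:45Z; kernel ref1-C77-imc-g17-audit.lean 2b1e3c6fcaef7823 rc 0, axioms 8/8 standard; BC7 probes ref1-C77P 8c8bb2d857814607 CLEAN 9/9): SURVIVES as LAW (typed consistently, T-8); 𝔐₀ NO-GO (6e) VALID and sharpened (W′ = γW, γ = (pb−8a, a; −2pb, pb−2a) ∈ Γ₀(2p), so the constant term vanishes identically); nothing asserted.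
[conjecture — cell candidate / theorem on paper, NOT a tree fact] -/
@[conjecture]
def FourPNoZeroEisensteinThreeModEight : Prop :=
  ∀ (p : ℕ) [NeZero (4 * p)], p.Prime → p % 8 = 3 →
    ¬ ∃ F : CuspForm (Gamma0 (4 * p)) 2, IsCongruentAtFourP p 1 (eisZeroOneCoeff p) F

/-- Sanity: `a₁(E⁰) = 1`, `a₂(E⁰) = 0` (`U₂ E⁰ = 0`), `a₃(E⁰) = 4 = 1 + 3`. [folklore] -/
theorem eisZeroCoeff_one_two_three : eisZeroCoeff 1 = 1 ∧ eisZeroCoeff 2 = 0 ∧ eisZeroCoeff 3 = 4 := by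
  refine ⟨?_, ?_, ?_⟩ <;> decide

/-- **EDGE (kernel-checked): E-imc-124 ⟹ at level `4p`, `p ≡ ±3 (8)`, NO integral cusp form is `≡ E_{2,2p} (mod 2)`** — i.e. the maximal
ideal `𝔐₁ = (2, U₂ − 1, U_p − 1, T_r − 1 − r)` is the unit ideal of `𝕋(4p)`; this contains tree E-81 for these `p`, and Mazur's prime-level `ℓ = 2`
statement GIVEN the local input [Edixhoven1992, Thm. 2.5/2.6] that a level-`p` 2-Eisenstein eigenform has `ā₂ = 1` (REF1 §R70 (6d)(i) =
GAP F-1; PROOFS-g17 §6 (6d)). [folklore] -/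
theorem fourP_no_twoTwoP_congruence_of_depth (h124 : FourPOldEisensteinCongruenceDepth) (p : ℕ) [NeZero (4 * p)]
    (hp : p.Prime) (hmod : p % 8 = 3 ∨ p % 8 = 5) :
    ¬ ∃ F : CuspForm (Gamma0 (4 * p)) 2, IsCongruentAtFourP p 1 (eisTwoTwoPCoeff p) F := by
  intro hex
  have hp2 : p ≠ 2 := by rintro rfl; omega
  have hodd : Odd p := hp.odd_of_ne_two hp2
  have h2 : 2 ^ 1 ∣ (p ^ 2 - 1) / 8 := h124 p hp hodd 1 hex
  exact not_two_dvd_sq_sub_one_div_eight hmod (by simpa using h2)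

/-- **EDGE (kernel-checked): the conditional `u₂ = 0` depth law E-imc-122 is BLIND at `p ≡ 3 (8)` only by one digit — it does give:
no integral cusp form of level `4p` is `≡ E^{(0,1)} (mod 4)` when `p ≡ 3 (mod 4)`.** [folklore] -/
theorem fourP_no_zeroOne_congruence_mod_four (h122 : FourPZeroEisensteinCongruenceDepth) (p : ℕ) [NeZero (4 * p)]
    (hp : p.Prime) (hmod : p % 4 = 3) :
    ¬ ∃ F : CuspForm (Gamma0 (4 * p)) 2, IsCongruentAtFourP p 2 (eisZeroOneCoeff p) F := by
  intro hex
  have hp2 : p ≠ 2 := by rintro rfl; omega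
  have hodd : Odd p := hp.odd_of_ne_two hp2
  have h4 : 2 ^ 2 ∣ p - 1 := (h122 p hp hodd 2).1 hex
  omega

/-- The conjectured exact `u₂ = 0` Eisenstein congruence depth at level `4p` (E-imc-126): `v₂(p − 1) − 1 + [p ≡ 7 (mod 8)]`. [conjecture] -/
def zeroOneDepth (p : ℕ) : ℕ :=
  padicValNat 2 (p - 1) - 1 + (if p % 8 = 7 then 1 else 0)

/-- **Candidate E-imc-126 `FourPZeroOneEisensteinDepthLaw` (LAW, PRE-REGISTERED 2026-08-28 on the rows p ≤ 31 of ENGINE 5b and scored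
out of sample; MEMO-imc §23 (10e′)).**  For every prime `p ≥ 5` the exact depth of the congruence «integral cusp form of level `4p`
`≡ E^{(0,1)} (mod 2^a)`, `n ≥ 1`» is `zeroOneDepth p = v₂(p − 1) − 1 + [p ≡ 7 (8)]`: one 2-adic digit LESS than the constant-term bound of
E-imc-122 (uniformly in `p`), one digit MORE than Mazur's prime-level depth `v₂ num((p−1)/12) = v₂(p−1) − 2` (the additive level-raising
digit; at `p ≡ 5 (8)` it is the blind tame family's own congruence), plus the `U₂ = 0` old classes of the level-`2p` 2-Eisenstein newforms at
`p ≡ 7 (8)`.  Contains E-imc-125 (`p ≡ 3 (8)`: depth `0`).  BC5: 11/11 levels `p ≤ 41` (9 fit + 2 predicted). [conjecture]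
Cell bsd-f2-manin row E-imc-126 (LAW, pre-registered; 11/11 p ≤ 41); typed VERBATIM from HOME/imc/Sketch-imc-g17.lean 59ad62fc9d3f9773 (typer g13, T-imc-16); REF1 §R70 (R-imc-46/48, HOME/ref1/R70-ref1-imc-g17.md 273a48013e319bbf, 2026-08-28T15:45Z; kernel ref1-C77-imc-g17-audit.lean 2b1e3c6fcaef7823 rc 0, axioms 8/8 standard; BC7 probes ref1-C77P 8c8bb2d857814607 CLEAN 9/9): SURVIVES as LAW (typed consistently, T-8; pre-registered census is imc's); nothing asserted.
[conjecture — cell candidate / theorem on paper, NOT a tree fact] -/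
@[conjecture]
def FourPZeroOneEisensteinDepthLaw : Prop :=
  ∀ (p : ℕ) [NeZero (4 * p)], p.Prime → 5 ≤ p → ∀ a : ℕ,
    (∃ F : CuspForm (Gamma0 (4 * p)) 2, IsCongruentAtFourP p a (eisZeroOneCoeff p) F) ↔ a ≤ zeroOneDepth p

/-- `v₂(2^k · m) = k` for odd `m` (evaluation helper). [folklore] -/
theorem padicValNat_two_of_eq {n k m : ℕ} (h : n = 2 ^ k * m) (hm : ¬ 2 ∣ m) : padicValNat 2 n = k := by
  have hm0 : m ≠ 0 := by rintro rfl; simp at hm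
  subst h
  rw [padicValNat.mul (by positivity) hm0, padicValNat.prime_pow, padicValNat.eq_zero_of_not_dvd hm, add_zero]

/-- Sanity of the bookkeeping function at `p = 5, 11, 23, 41` (classes 5, 3, 7, 1 mod 8): depths `1, 0, 1, 2` (= ENGINE 5b column `(0,1)`). [folklore] -/
theorem zeroOneDepth_values :
    zeroOneDepth 5 = 1 ∧ zeroOneDepth 11 = 0 ∧ zeroOneDepth 23 = 1 ∧ zeroOneDepth 41 = 2 := by
  refine ⟨?_, ?_, ?_, ?_⟩ <;> simp only [zeroOneDepth]
  · rw [padicValNat_two_of_eq (k := 2) (m := 1) (by norm_num) (by norm_num)]; norm_num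
  · rw [padicValNat_two_of_eq (k := 1) (m := 5) (by norm_num) (by norm_num)]; norm_num
  · rw [padicValNat_two_of_eq (k := 1) (m := 11) (by norm_num) (by norm_num)]; norm_num
  · rw [padicValNat_two_of_eq (k := 3) (m := 5) (by norm_num) (by norm_num)]; norm_num

end Summit.BirchSwinnertonDyer.Rank1Residual.ManinAdditive.TwoEisenstein
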